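/-
Copyright (c) 2026 the pub-hodgecm-mathlib formalisation cell (harness21).  R90-TF SLAB, section S10 (Rogawski 1990, Ch. 13.8), prover R90-C138-p01 (g0):
DEAL #64 (dealer R90-C138-plan (g3), 2026-09-05T03:04:09Z; census `R90/R90-C138-p01/g0/CENSUS-DEAL64-hexFamily.md` 43911859571c1c18) — the keystone's ROW-6
`hex` FAMILY at the frozen datum from the (3′) junction; h413 = `stmt-HodgeConjecture-24833`, route `HCCMUnconditional`.
-/
import Summits.HodgeConjecture.HodgeConjecture.Theorems.R90S10RigidityAtGermOfLetters          -- ★ p07: the CONSUMER shapes (`hex` :255∕:300) + ★ `exists_liesOver_frozen_of_pinnedPartner`; ★ C2 `S10FrozenDatum`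
import Summits.HodgeConjecture.HodgeConjecture.Theorems.R90S10PSLocalCharTransferPinnedLetters  -- ★ p864723 (p02): `exists_pinnedAt_of_abstractLetter`, `PSLocalCharTransferPinnedAt`
import Summits.HodgeConjecture.HodgeConjecture.Theorems.R90S10UnramCharIdentityOfLetters        -- ★ p864554 (this seat): (J) `psLocalCharTransferAbstractLetter_of_letters`
import Summits.HodgeConjecture.HodgeConjecture.Theorems.R90S10SplitHVanDijkLetterHolds          -- ★ (p03 (R1)″): `splitHVanDijkLetter_holds` — (M-a) UNCONDITIONAL
import Summits.HodgeConjecture.HodgeConjecture.Theorems.R90S10SplitAbstractTransfer             -- ★ (p08 (B)): `splitAbstractTransferLetter_holds` — (M-b′) UNCONDITIONAL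
import HarnessLib

/-!
# R90-TF ∕ S10 — THE KEYSTONE'S ROW-6 `hex` FAMILY AT THE FROZEN DATUM: `exists_liesOver_frozen_of_letters`, `exists_eigenvaluePackage_hexFamily(_of_subset)`

Cell hodgecm-mathlib, slab R90-TF, section S10 = [Rogawski1990] §13.8 (p. 219 L2–L3), crux item h413 = `stmt-HodgeConjecture-24833`; kernel lane
`--kind proof --supports stmt-HodgeConjecture-24833 --as helper`; THEOREMS ONLY (no `def`, no instance, no notation, no `sorry`); never imports `Cruxes/…/Lines`.

WHAT.  p07's (P-rig) payers ★ `rigidityAtGermLetter_of_exists_liesOver` (:255) ∕ `rigidityAtGermLetter_subtype_of_exists_liesOver` (:300) take the binder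
`hex : ∀ w ≠ v (∉ S), ∃ π₀ : IrrClass (Gqs L w), π₀.IsAdmissible ∧ ∃ h₀ : π₀.IsSpherical (U(Φ₃)(𝒪_w)), unopClassSphericalCharacter … π₀ h₀ = t₀ w ∧ LiesOver … π₀ (𝔥.ρ w)`
(«`ξ_H(ρ_w)` exists as a class of character `(t₀)_w` lying over `ρ_w`»).  THIS FILE supplies it at the frozen datum `𝔣 : S10FrozenDatum …` from the letters, with the
package `t₀` as an ∃-WITNESS:
* `exists_liesOver_frozen_of_letters` (one place `w ≠ v`): the abstract letter (3′) ★ `PSLocalCharTransferAbstractLetter` holds at the frozen vector's off-`v` data BY ★ (J)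
  `psLocalCharTransferAbstractLetter_of_letters`, fed by ★ `splitHVanDijkLetter_holds` ((M-a), unconditional), ★ `splitAbstractTransferLetter_holds` ((M-b′), unconditional),
  the frozen vector's own unit-transfer FIELD `𝔳.htrf w` (the pair `(𝟙_{K_{H,w}}, 𝟙_{K_w})` IS a `Δ‴_w`-transfer — consumed when `𝔳` was built, A2c♯; rewritten to the standard
  levels by `𝔳.hKstd`, `𝔥.hKH`, `𝔥.hK₂std`, `𝔥.hK₁std`), `μ|_{𝕀_{L⁺}} = ω` and the frozen canonicity fields `𝔳.hmH w`, `𝔳.hmQ w`; its guards are ⟪U⟫_w, `rfl`, and the unit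
  volumes `𝔳.hνHK w`, `𝔳.hνQK w`.  ★ `exists_pinnedAt_of_abstractLetter` (p02) then pins the partner's own parameter `t_w`, and ★ `exists_liesOver_frozen_of_pinnedPartner` (p07)
  is the `hex` body at `t_w`.  The ONE residual input is `hPS`-data: `ρ_w ≅ i_H(χ₂ ⊠ χ₁)` (`χ₁` smooth) WITH a `K_{H,w}`-line [§12.1 p. 171; §4.5 p. 45] (census F2, class (E1-c)⁺-local).
* `exists_eigenvaluePackage_hexFamily` ∕ `…_of_subset`: choice over `w ≠ v` packages the parameters into `t₀ : Ch13Sec6.EigenvaluePackage S …` (`S = {v}`, resp. `v ∈ S ⊆ {v}`),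
  conclusion = the `hex` binder of :300, resp. :255, VERBATIM.
So at the keystone, ROW 6's (P-rig) is `rigidityAtGermLetter_(subtype_)of_exists_liesOver … t₀ hex` with `⟨t₀, hex⟩` obtained here; the H-side pin `ht₀` is then stated at THIS `t₀`.

HONEST LABEL: pays the `hex` binder modulo `hPS` (PS-realisation with a `K_H`-line off `v`, (E1-c)⁺-local) and the regime ⟪P⟫ ⟪U⟫; HC_CM is proved only modulo the 7 printed
citations (2 remaining named inputs: hLiu418 = `stmt-HodgeConjecture-24832`, h413 = `stmt-HodgeConjecture-24833`) until rung 0 closes; REL ≠ ★ ≠ BUILT.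

## References
* [Rogawski1990] J. Rogawski, *Automorphic Representations of Unitary Groups in Three Variables*, Ann. of Math. Stud. 123 (1990), §13.8 p. 218 L12, p. 219 L2–L3; §4.9 Prop.
  4.9.1 (b) p. 55, Lemma 4.9.2 pp. 55–56; §4.13 Lemma 4.13.1 pp. 64–66; §12.1 p. 171; §13.1 p. 199 ¶3; §13.6 p. 209.
* [CartierCorvallis1979] P. Cartier, *Representations of 𝔭-adic groups: a survey*, Proc. Sympos. Pure Math. 33.1 (1979), §IV.1 Cor. 4.1–4.2.
* [vanDijk1972] G. van Dijk, *Computation of certain induced characters of 𝔭-adic groups*, Math. Ann. 199 (1972), Thm. p. 237.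
-/

set_option autoImplicit false
set_option linter.dupNamespace false

noncomputable section

open scoped RestrictedProduct Matrix MatrixGroups
open Filter MeasureTheory NumberField IsDedekindDomain CompactlySupported
open Literature.NumberTheory.Rogawski1990 Literature.NumberTheory.Automorphic Literature.NumberTheory.Automorphic.UnitaryGroup
open Literature.NumberTheory.Automorphic.UnitaryGroup.CotangentForms Literature.NumberTheory.GaloisRepresentations
open Literature.NumberTheory.Automorphic.Arthur2013.Leaves.TECR
open Summit.HodgeConjecture.HodgeConjecture.Cruxes.H413
open Summit.HodgeConjecture.HodgeConjecture.Cruxes.H413.K2E1TraceFormulaBeta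
open Summit.HodgeConjecture.HodgeConjecture.Cruxes.H413.K2E1SpectralTermsDiscreteHalf
open Summit.HodgeConjecture.HodgeConjecture.Cruxes.H413.K2E1EvpOfAutomorphicClass

namespace Summit.HodgeConjecture.HodgeConjecture.R90.S10

section Frozen

variable {L : Type} [Field L] [NumberField L] [IsCMField L] [DecidableEq (Pl L)] {μ : HeckeCharacter L} {v : Pl L}
  [MeasurableSpace (HLoc L v)] [BorelSpace (HLoc L v)] [MeasurableSpace (Gqs L v)] [BorelSpace (Gqs L v)]
  {νHv : Measure (HLoc L v)} {νQv : Measure (Gqs L v)} [νHv.IsHaarMeasure] [νHv.IsMulRightInvariant] [νQv.IsHaarMeasure] [νQv.IsMulRightInvariant]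
  [∀ a : HLoc L v, MeasurableSpace (HLoc L v ⧸ Subgroup.centralizer ({a} : Set (HLoc L v)))]
  [∀ a : HLoc L v, BorelSpace (HLoc L v ⧸ Subgroup.centralizer ({a} : Set (HLoc L v)))]
  [∀ γ : Gqs L v, MeasurableSpace (Gqs L v ⧸ Subgroup.centralizer ({γ} : Set (Gqs L v)))]
  [∀ γ : Gqs L v, BorelSpace (Gqs L v ⧸ Subgroup.centralizer ({γ} : Set (Gqs L v)))]
  {mHv : OrbitalMeasureFamily (HLoc L v)} {mQv : OrbitalMeasureFamily (Gqs L v)} {πSt : IrrClass (HLoc L v)}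
  [MeasurableSpace (G3 L).Adelic] [BorelSpace (G3 L).Adelic] [MeasurableSpace (H2 L).Adelic] [BorelSpace (H2 L).Adelic]
  [MeasurableSpace (GArch L)] [BorelSpace (GArch L)] [MeasurableSpace (HArch L)] [BorelSpace (HArch L)]
  [MeasurableSpace (H1Loc L v)] [MeasurableSpace (H1Arch L)] [MeasurableSpace (H1 L).Adelic] [BorelSpace (H1 L).Adelic]

/-- **THE `hex` WITNESS AT ONE PLACE `w ≠ v` FROM THE LETTERS** — at the frozen datum, for `μ|_{𝕀_{L⁺}} = ω`, ⟪U⟫ at `w` and `ρ_w ≅ i_H(χ₂ ⊠ χ₁)` (`χ₁` smooth) with a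
`K_{H,w}`-line: SOME admissible `U(Φ₃)(𝒪_w)`-spherical class `π₀` with spherical character `t_w` LIES OVER `ρ_w` — (3′) by ★ (J) over the unconditional ★ (M-a)/(M-b′) and the
frozen unit transfer `𝔳.htrf w`; the pin by ★ `exists_pinnedAt_of_abstractLetter`; the class by ★ `exists_liesOver_frozen_of_pinnedPartner`.
[cite: Rogawski1990, §13.8 p. 219 L2–L3; §4.9 Lemma 4.9.2 pp. 55–56, Prop. 4.9.1 (b) p. 55; §13.6 p. 209] [cite: CartierCorvallis1979, §IV.1 Cor. 4.1–4.2] [cite: vanDijk1972, Thm. p. 237] -/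
theorem exists_liesOver_frozen_of_letters
    (hμω : ∀ x : Literature.NumberTheory.GaloisRepresentations.ideleGroup ↥(maximalRealSubfield L),
      μ (AdeleRing.ideleBaseChange (↥(maximalRealSubfield L)) L x) = quadraticHeckeCharCM L x)
    (𝔣 : S10FrozenDatum L μ v νHv νQv mHv mQv πSt) (w : {w : Pl L // w ≠ v})
    (hU : ∀ W : PlacesOver L w.1, Algebra.IsUnramifiedAt (𝓞 ↥(maximalRealSubfield L)) W.1.asIdeal ∧ μ.IsUnramifiedAt W.1)
    (χ₂ : ↥(torusU (conjLocal L (IsCMField.complexConj L) w.1) (cmLocalForm L 2 w.1)) →* ℂˣ) (χ₁ : H1Loc L w.1 →* ℂˣ)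
    (hχ₁ : IsOpen ((χ₁.ker : Subgroup (H1Loc L w.1)) : Set (H1Loc L w.1)))
    (hρ : letI := 𝔣.𝔥.acV w.1
      letI := 𝔣.𝔥.mdV w.1
      Nonempty ((𝔣.𝔥.ρ w.1).Equiv (cmPrincipalSeriesH L w.1 χ₂ χ₁)))
    (hline : letI := 𝔣.𝔥.acV w.1
      letI := 𝔣.𝔥.mdV w.1
      Module.finrank ℂ ↥((𝔣.𝔥.ρ w.1).fixedPoints (𝔣.𝔥.KH w.1)) = 1) :
    ∃ tw : heckeAlgebra ℂ (Gqs L w.1) (cmLocalIntegralLevel L 3 (qsForm L) w.1) →ₐ[ℂ] ℂ,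
      ∃ π₀ : IrrClass (Gqs L w.1), π₀.IsAdmissible ∧ ∃ h₀ : π₀.IsSpherical (cmLocalIntegralLevel L 3 (qsForm L) w.1),
        unopClassSphericalCharacter (cmLocalIntegralLevel L 3 (qsForm L) w.1) π₀ h₀ = tw ∧
          LiesOver L μ w.1 (𝔣.𝔳.K w.1) (𝔣.𝔥.KH w.1) (𝔣.𝔳.νQ w) (𝔣.𝔳.νHw w) (𝔣.𝔳.mH w) (𝔣.𝔳.mQ w) π₀ (𝔣.𝔥.ρ w.1) := by
  letI := 𝔣.𝔳.msG w
  letI := 𝔣.𝔳.msH w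
  haveI := 𝔣.𝔳.bsG w
  haveI := 𝔣.𝔳.bsH w
  letI := 𝔣.𝔳.qH w
  letI := 𝔣.𝔳.qQ w
  haveI := 𝔣.𝔳.bqH w
  haveI := 𝔣.𝔳.bqQ w
  haveI := 𝔣.𝔳.hνQ w
  haveI := 𝔣.𝔳.hνQr w
  haveI := 𝔣.𝔳.hνHw w
  haveI := 𝔣.𝔳.hνHwr w
  letI := 𝔣.𝔥.acV w.1
  letI := 𝔣.𝔥.mdV w.1
  -- the level pins off `v`
  have hKG : 𝔣.𝔳.K w.1 = cmLocalIntegralLevel L 3 (qsForm L) w.1 := 𝔣.𝔳.hKstd w.1 w.2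
  have hKH : 𝔣.𝔥.KH w.1 = (cmLocalIntegralLevel L 2 (Matrix.of fun i j : Fin 2 => if i.val + j.val + 1 = 2 then (1 : L) else 0) w.1).prod
      (cmLocalIntegralLevel L 1 (Matrix.of fun i j : Fin 1 => if i.val + j.val + 1 = 1 then (1 : L) else 0) w.1) := by
    rw [𝔣.𝔥.hKH w.1, 𝔣.𝔥.hK₂std w.1 w.2, 𝔣.𝔥.hK₁std w.1 w.2]
  -- the unit volumes (frozen normalisations)
  have hvolH : 𝔣.𝔳.νHw w (𝔣.𝔥.KH w.1 : Set (HLoc L w.1)) = 1 :=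
    (ENNReal.toReal_eq_one_iff _).1 (by rw [← measureReal_def]; exact 𝔣.𝔳.hνHK w)
  have hvolG : 𝔣.𝔳.νQ w (cmLocalIntegralLevel L 3 (qsForm L) w.1 : Set (Gqs L w.1)) = 1 :=
    (ENNReal.toReal_eq_one_iff _).1 (by rw [← measureReal_def, ← hKG]; exact 𝔣.𝔳.hνQK w)
  -- the frozen unit transfer IS the unit identity at the standard levels
  have hUT : IsLocalUnitTransfer L (qsForm L) w.1 ((finExplicitCollection L (qsForm L) μ (finExplicitDelta_conj_left_all L (qsForm L) μ)
      (finExplicitDelta_conj_right_all L (qsForm L) μ)) w.1) (𝔣.𝔳.mH w) (𝔣.𝔳.mQ w) := by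
    have h := 𝔣.𝔳.htrf w
    rw [hKH, hKG] at h
    exact h
  -- (3′) at the frozen data, by the junction (J) over (M-a), (M-b′) ★ and the frozen unit transfer
  have h3 : PSLocalCharTransferAbstractLetter L μ w.1 (cmLocalIntegralLevel L 3 (qsForm L) w.1) (𝔣.𝔥.KH w.1) (𝔣.𝔳.νQ w) (𝔣.𝔳.νHw w)
      (𝔣.𝔳.mH w) (𝔣.𝔳.mQ w) :=
    psLocalCharTransferAbstractLetter_of_letters L μ w.1 (cmLocalIntegralLevel L 3 (qsForm L) w.1) (𝔣.𝔥.KH w.1) (𝔣.𝔳.νQ w) (𝔣.𝔳.νHw w)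
      (𝔣.𝔳.mH w) (𝔣.𝔳.mQ w) (splitHVanDijkLetter_holds L w.1 μ (𝔣.𝔳.νHw w) (𝔣.𝔳.mH w) (𝔣.𝔳.mQ w))
      (splitAbstractTransferLetter_holds L μ w.1 (𝔣.𝔳.νQ w) (𝔣.𝔳.νHw w)) (fun _ _ _ _ => hUT) hμω (𝔣.𝔳.hmH w) (𝔣.𝔳.hmQ w)
  -- the partner pinned at its own parameter, and the class lying over `ρ_w`
  obtain ⟨tw, W, _, _, I, hI, ⟨hlineI, hIt⟩, hβI⟩ := exists_pinnedAt_of_abstractLetter L μ w.1 (cmLocalIntegralLevel L 3 (qsForm L) w.1) (𝔣.𝔥.KH w.1)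
    (𝔣.𝔳.νQ w) (𝔣.𝔳.νHw w) (𝔣.𝔳.mH w) (𝔣.𝔳.mQ w) h3 hU rfl hKH hvolH hvolG χ₂ χ₁ hχ₁ (𝔣.𝔥.ρ w.1) hρ hline
  exact ⟨tw, exists_liesOver_frozen_of_pinnedPartner 𝔣 w tw I hI hlineI hIt hβI⟩

/-- **THE KEYSTONE'S `hex` FAMILY WITH ITS PACKAGE (`S = {v}`)** — choice over `w ≠ v` in `exists_liesOver_frozen_of_letters`: an e.v.p. package `t₀` off `v` at the standard
levels and, at every `w ≠ v`, an admissible spherical class of character `(t₀)_w` lying over `ρ_w` — the binder `hex` of ★ `rigidityAtGermLetter_subtype_of_exists_liesOver`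
VERBATIM, modulo ⟪U⟫ off `v`, `μ|_{𝕀_{L⁺}} = ω` and the PS-realisation data `hPS`. [cite: Rogawski1990, §13.8 p. 219 L2–L3; §13.6 p. 209; §12.1 p. 171]
[cite: CartierCorvallis1979, §IV.1 Cor. 4.1–4.2] -/
theorem exists_eigenvaluePackage_hexFamily
    (hunr : ∀ w : Pl L, w ≠ v → ∀ W : PlacesOver L w, Algebra.IsUnramifiedAt (𝓞 ↥(maximalRealSubfield L)) W.1.asIdeal ∧ μ.IsUnramifiedAt W.1)
    (hμω : ∀ x : Literature.NumberTheory.GaloisRepresentations.ideleGroup ↥(maximalRealSubfield L),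
      μ (AdeleRing.ideleBaseChange (↥(maximalRealSubfield L)) L x) = quadraticHeckeCharCM L x)
    (𝔣 : S10FrozenDatum L μ v νHv νQv mHv mQv πSt)
    (hPS : ∀ w : {w : Pl L // w ≠ v}, ∃ (χ₂ : ↥(torusU (conjLocal L (IsCMField.complexConj L) w.1) (cmLocalForm L 2 w.1)) →* ℂˣ) (χ₁ : H1Loc L w.1 →* ℂˣ),
      IsOpen ((χ₁.ker : Subgroup (H1Loc L w.1)) : Set (H1Loc L w.1)) ∧
        (letI := 𝔣.𝔥.acV w.1
         letI := 𝔣.𝔥.mdV w.1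
         Nonempty ((𝔣.𝔥.ρ w.1).Equiv (cmPrincipalSeriesH L w.1 χ₂ χ₁)) ∧ Module.finrank ℂ ↥((𝔣.𝔥.ρ w.1).fixedPoints (𝔣.𝔥.KH w.1)) = 1)) :
    ∃ t₀ : Ch13Sec6.EigenvaluePackage ({v} : Set (Pl L)) fun w => heckeAlgebra ℂ (Gqs L w) (cmLocalIntegralLevel L 3 (qsForm L) w),
      ∀ w : {w : Pl L // w ≠ v}, ∃ π₀ : IrrClass (Gqs L w.1), π₀.IsAdmissible ∧ ∃ h₀ : π₀.IsSpherical (cmLocalIntegralLevel L 3 (qsForm L) w.1),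
        unopClassSphericalCharacter (cmLocalIntegralLevel L 3 (qsForm L) w.1) π₀ h₀ = t₀ ⟨w.1, fun h => w.2 (Set.mem_singleton_iff.1 h)⟩ ∧
          LiesOver L μ w.1 (𝔣.𝔳.K w.1) (𝔣.𝔥.KH w.1) (𝔣.𝔳.νQ w) (𝔣.𝔳.νHw w) (𝔣.𝔳.mH w) (𝔣.𝔳.mQ w) π₀ (𝔣.𝔥.ρ w.1) := by
  have key : ∀ w : {w : Pl L // w ≠ v}, ∃ tw : heckeAlgebra ℂ (Gqs L w.1) (cmLocalIntegralLevel L 3 (qsForm L) w.1) →ₐ[ℂ] ℂ,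
      ∃ π₀ : IrrClass (Gqs L w.1), π₀.IsAdmissible ∧ ∃ h₀ : π₀.IsSpherical (cmLocalIntegralLevel L 3 (qsForm L) w.1),
        unopClassSphericalCharacter (cmLocalIntegralLevel L 3 (qsForm L) w.1) π₀ h₀ = tw ∧
          LiesOver L μ w.1 (𝔣.𝔳.K w.1) (𝔣.𝔥.KH w.1) (𝔣.𝔳.νQ w) (𝔣.𝔳.νHw w) (𝔣.𝔳.mH w) (𝔣.𝔳.mQ w) π₀ (𝔣.𝔥.ρ w.1) := fun w => by
    obtain ⟨χ₂, χ₁, hχ₁, hρ, hline⟩ := hPS w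
    exact exists_liesOver_frozen_of_letters hμω 𝔣 w (hunr w.1 w.2) χ₂ χ₁ hχ₁ hρ hline
  choose t ht using key
  exact ⟨fun i => t ⟨i.1, fun h => i.2 (Set.mem_singleton_iff.2 h)⟩, fun w => ht w⟩

/-- **THE SAME FAMILY, `S`-INDEXED (`v ∈ S ⊆ {v}`)** — the binder `hex` of ★ `rigidityAtGermLetter_of_exists_liesOver` VERBATIM (package indexed by `{w // w ∉ S}`).
[cite: Rogawski1990, §13.8 p. 219 L2–L3; §13.6 p. 209] [cite: CartierCorvallis1979, §IV.1 Cor. 4.1–4.2] -/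
theorem exists_eigenvaluePackage_hexFamily_of_subset
    (hunr : ∀ w : Pl L, w ≠ v → ∀ W : PlacesOver L w, Algebra.IsUnramifiedAt (𝓞 ↥(maximalRealSubfield L)) W.1.asIdeal ∧ μ.IsUnramifiedAt W.1)
    (hμω : ∀ x : Literature.NumberTheory.GaloisRepresentations.ideleGroup ↥(maximalRealSubfield L),
      μ (AdeleRing.ideleBaseChange (↥(maximalRealSubfield L)) L x) = quadraticHeckeCharCM L x)
    (𝔣 : S10FrozenDatum L μ v νHv νQv mHv mQv πSt) (S : Set (Pl L)) (hv : v ∈ S)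
    (hPS : ∀ w : {w : Pl L // w ≠ v}, ∃ (χ₂ : ↥(torusU (conjLocal L (IsCMField.complexConj L) w.1) (cmLocalForm L 2 w.1)) →* ℂˣ) (χ₁ : H1Loc L w.1 →* ℂˣ),
      IsOpen ((χ₁.ker : Subgroup (H1Loc L w.1)) : Set (H1Loc L w.1)) ∧
        (letI := 𝔣.𝔥.acV w.1
         letI := 𝔣.𝔥.mdV w.1
         Nonempty ((𝔣.𝔥.ρ w.1).Equiv (cmPrincipalSeriesH L w.1 χ₂ χ₁)) ∧ Module.finrank ℂ ↥((𝔣.𝔥.ρ w.1).fixedPoints (𝔣.𝔥.KH w.1)) = 1)) :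
    ∃ t₀ : Ch13Sec6.EigenvaluePackage S fun w => heckeAlgebra ℂ (Gqs L w) (cmLocalIntegralLevel L 3 (qsForm L) w),
      ∀ (w : {w : Pl L // w ≠ v}) (hwS : w.1 ∉ S), ∃ π₀ : IrrClass (Gqs L w.1), π₀.IsAdmissible ∧ ∃ h₀ : π₀.IsSpherical (cmLocalIntegralLevel L 3 (qsForm L) w.1),
        unopClassSphericalCharacter (cmLocalIntegralLevel L 3 (qsForm L) w.1) π₀ h₀ = t₀ ⟨w.1, hwS⟩ ∧
          LiesOver L μ w.1 (𝔣.𝔳.K w.1) (𝔣.𝔥.KH w.1) (𝔣.𝔳.νQ w) (𝔣.𝔳.νHw w) (𝔣.𝔳.mH w) (𝔣.𝔳.mQ w) π₀ (𝔣.𝔥.ρ w.1) := by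
  have key : ∀ w : {w : Pl L // w ≠ v}, ∃ tw : heckeAlgebra ℂ (Gqs L w.1) (cmLocalIntegralLevel L 3 (qsForm L) w.1) →ₐ[ℂ] ℂ,
      ∃ π₀ : IrrClass (Gqs L w.1), π₀.IsAdmissible ∧ ∃ h₀ : π₀.IsSpherical (cmLocalIntegralLevel L 3 (qsForm L) w.1),
        unopClassSphericalCharacter (cmLocalIntegralLevel L 3 (qsForm L) w.1) π₀ h₀ = tw ∧
          LiesOver L μ w.1 (𝔣.𝔳.K w.1) (𝔣.𝔥.KH w.1) (𝔣.𝔳.νQ w) (𝔣.𝔳.νHw w) (𝔣.𝔳.mH w) (𝔣.𝔳.mQ w) π₀ (𝔣.𝔥.ρ w.1) := fun w => by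
    obtain ⟨χ₂, χ₁, hχ₁, hρ, hline⟩ := hPS w
    exact exists_liesOver_frozen_of_letters hμω 𝔣 w (hunr w.1 w.2) χ₂ χ₁ hχ₁ hρ hline
  choose t ht using key
  exact ⟨fun i => t ⟨i.1, fun h => i.2 (h ▸ hv)⟩, fun w _ => ht w⟩

end Frozen

/-! ## Appendix (DEAL #69 road (b), K2Liu-p13 (g5) census 9eb93b61): the same witness for an ARBITRARY realisation `ρw` at the frozen data -/

section FrozenGeneric

variable {L : Type} [Field L] [NumberField L] [IsCMField L] [DecidableEq (Pl L)] {μ : HeckeCharacter L} {v : Pl L}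
  [MeasurableSpace (HLoc L v)] [BorelSpace (HLoc L v)] [MeasurableSpace (Gqs L v)] [BorelSpace (Gqs L v)]
  {νHv : Measure (HLoc L v)} {νQv : Measure (Gqs L v)} [νHv.IsHaarMeasure] [νHv.IsMulRightInvariant] [νQv.IsHaarMeasure] [νQv.IsMulRightInvariant]
  [∀ a : HLoc L v, MeasurableSpace (HLoc L v ⧸ Subgroup.centralizer ({a} : Set (HLoc L v)))]
  [∀ a : HLoc L v, BorelSpace (HLoc L v ⧸ Subgroup.centralizer ({a} : Set (HLoc L v)))]
  [∀ γ : Gqs L v, MeasurableSpace (Gqs L v ⧸ Subgroup.centralizer ({γ} : Set (Gqs L v)))]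
  [∀ γ : Gqs L v, BorelSpace (Gqs L v ⧸ Subgroup.centralizer ({γ} : Set (Gqs L v)))]
  {mHv : OrbitalMeasureFamily (HLoc L v)} {mQv : OrbitalMeasureFamily (Gqs L v)} {πSt : IrrClass (HLoc L v)}
  [MeasurableSpace (G3 L).Adelic] [BorelSpace (G3 L).Adelic] [MeasurableSpace (H2 L).Adelic] [BorelSpace (H2 L).Adelic]
  [MeasurableSpace (GArch L)] [BorelSpace (GArch L)] [MeasurableSpace (HArch L)] [BorelSpace (HArch L)]
  [MeasurableSpace (H1Loc L v)] [MeasurableSpace (H1Arch L)] [MeasurableSpace (H1 L).Adelic] [BorelSpace (H1 L).Adelic]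

/-- **THE `hex` WITNESS AT `w ≠ v` FOR AN ARBITRARY `ρ_w ≅ i_H(χ₂ ⊠ χ₁)` AT THE FROZEN DATA** (`ρw`-generic form of `exists_liesOver_frozen_of_letters`; at
`ρw := cmPrincipalSeriesH L w χ₂ χ₁` itself with `⟨Representation.Equiv.refl _⟩` it is K2Liu-p13's (H1♭), whose `LiesOver` is then moved onto `𝔥.ρ w` by level traces):
the (3′) junction ★ at the frozen measures ∕ families (unconditional (M-a), (M-b′), the frozen unit transfer `𝔳.htrf w`), the pin ★ `exists_pinnedAt_of_abstractLetter`, and the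
generic ★ `exists_liesOver_of_pinnedPartner` (p02) at the standard level `𝔳.K w = U(Φ₃)(𝒪_w)` (C2 `hKstd`). [cite: Rogawski1990, §13.8 p. 219 L2–L3; §4.9 Lemma 4.9.2 pp. 55–56;
§13.6 p. 209; §12.1 p. 171] [cite: CartierCorvallis1979, §IV.1 Cor. 4.1–4.2] -/
theorem exists_liesOver_at_frozen_of_letters
    (hμω : ∀ x : Literature.NumberTheory.GaloisRepresentations.ideleGroup ↥(maximalRealSubfield L),
      μ (AdeleRing.ideleBaseChange (↥(maximalRealSubfield L)) L x) = quadraticHeckeCharCM L x)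
    (𝔣 : S10FrozenDatum L μ v νHv νQv mHv mQv πSt) (w : {w : Pl L // w ≠ v})
    (hU : ∀ W : PlacesOver L w.1, Algebra.IsUnramifiedAt (𝓞 ↥(maximalRealSubfield L)) W.1.asIdeal ∧ μ.IsUnramifiedAt W.1)
    (χ₂ : ↥(torusU (conjLocal L (IsCMField.complexConj L) w.1) (cmLocalForm L 2 w.1)) →* ℂˣ) (χ₁ : H1Loc L w.1 →* ℂˣ)
    (hχ₁ : IsOpen ((χ₁.ker : Subgroup (H1Loc L w.1)) : Set (H1Loc L w.1)))
    {Vw : Type} [AddCommGroup Vw] [Module ℂ Vw] (ρw : Representation ℂ (HLoc L w.1) Vw)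
    (hρ : Nonempty (ρw.Equiv (cmPrincipalSeriesH L w.1 χ₂ χ₁))) (hline : Module.finrank ℂ ↥(ρw.fixedPoints (𝔣.𝔥.KH w.1)) = 1) :
    ∃ tw : heckeAlgebra ℂ (Gqs L w.1) (cmLocalIntegralLevel L 3 (qsForm L) w.1) →ₐ[ℂ] ℂ,
      ∃ π₀ : IrrClass (Gqs L w.1), π₀.IsAdmissible ∧ ∃ h₀ : π₀.IsSpherical (cmLocalIntegralLevel L 3 (qsForm L) w.1),
        unopClassSphericalCharacter (cmLocalIntegralLevel L 3 (qsForm L) w.1) π₀ h₀ = tw ∧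
          LiesOver L μ w.1 (𝔣.𝔳.K w.1) (𝔣.𝔥.KH w.1) (𝔣.𝔳.νQ w) (𝔣.𝔳.νHw w) (𝔣.𝔳.mH w) (𝔣.𝔳.mQ w) π₀ ρw := by
  letI := 𝔣.𝔳.msG w
  letI := 𝔣.𝔳.msH w
  haveI := 𝔣.𝔳.bsG w
  haveI := 𝔣.𝔳.bsH w
  letI := 𝔣.𝔳.qH w
  letI := 𝔣.𝔳.qQ w
  haveI := 𝔣.𝔳.bqH w
  haveI := 𝔣.𝔳.bqQ w
  haveI := 𝔣.𝔳.hνQ w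
  haveI := 𝔣.𝔳.hνQr w
  haveI := 𝔣.𝔳.hνHw w
  haveI := 𝔣.𝔳.hνHwr w
  have hKG : 𝔣.𝔳.K w.1 = cmLocalIntegralLevel L 3 (qsForm L) w.1 := 𝔣.𝔳.hKstd w.1 w.2
  have hKH : 𝔣.𝔥.KH w.1 = (cmLocalIntegralLevel L 2 (Matrix.of fun i j : Fin 2 => if i.val + j.val + 1 = 2 then (1 : L) else 0) w.1).prod
      (cmLocalIntegralLevel L 1 (Matrix.of fun i j : Fin 1 => if i.val + j.val + 1 = 1 then (1 : L) else 0) w.1) := by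
    rw [𝔣.𝔥.hKH w.1, 𝔣.𝔥.hK₂std w.1 w.2, 𝔣.𝔥.hK₁std w.1 w.2]
  have hvolH : 𝔣.𝔳.νHw w (𝔣.𝔥.KH w.1 : Set (HLoc L w.1)) = 1 :=
    (ENNReal.toReal_eq_one_iff _).1 (by rw [← measureReal_def]; exact 𝔣.𝔳.hνHK w)
  have hvolG : 𝔣.𝔳.νQ w (cmLocalIntegralLevel L 3 (qsForm L) w.1 : Set (Gqs L w.1)) = 1 :=
    (ENNReal.toReal_eq_one_iff _).1 (by rw [← measureReal_def, ← hKG]; exact 𝔣.𝔳.hνQK w)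
  have hUT : IsLocalUnitTransfer L (qsForm L) w.1 ((finExplicitCollection L (qsForm L) μ (finExplicitDelta_conj_left_all L (qsForm L) μ)
      (finExplicitDelta_conj_right_all L (qsForm L) μ)) w.1) (𝔣.𝔳.mH w) (𝔣.𝔳.mQ w) := by
    have h := 𝔣.𝔳.htrf w
    rw [hKH, hKG] at h
    exact h
  have h3 : PSLocalCharTransferAbstractLetter L μ w.1 (cmLocalIntegralLevel L 3 (qsForm L) w.1) (𝔣.𝔥.KH w.1) (𝔣.𝔳.νQ w) (𝔣.𝔳.νHw w)
      (𝔣.𝔳.mH w) (𝔣.𝔳.mQ w) :=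
    psLocalCharTransferAbstractLetter_of_letters L μ w.1 (cmLocalIntegralLevel L 3 (qsForm L) w.1) (𝔣.𝔥.KH w.1) (𝔣.𝔳.νQ w) (𝔣.𝔳.νHw w)
      (𝔣.𝔳.mH w) (𝔣.𝔳.mQ w) (splitHVanDijkLetter_holds L w.1 μ (𝔣.𝔳.νHw w) (𝔣.𝔳.mH w) (𝔣.𝔳.mQ w))
      (splitAbstractTransferLetter_holds L μ w.1 (𝔣.𝔳.νQ w) (𝔣.𝔳.νHw w)) (fun _ _ _ _ => hUT) hμω (𝔣.𝔳.hmH w) (𝔣.𝔳.hmQ w)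
  obtain ⟨tw, W, _, _, I, hI, ⟨hlineI, hIt⟩, hβI⟩ := exists_pinnedAt_of_abstractLetter L μ w.1 (cmLocalIntegralLevel L 3 (qsForm L) w.1) (𝔣.𝔥.KH w.1)
    (𝔣.𝔳.νQ w) (𝔣.𝔳.νHw w) (𝔣.𝔳.mH w) (𝔣.𝔳.mQ w) h3 hU rfl hKH hvolH hvolG χ₂ χ₁ hχ₁ ρw hρ hline
  have hK := isCompact_isOpen_cmLocalIntegralLevel L 3 (qsForm L) w.1
  rw [hKG]
  exact ⟨tw, exists_liesOver_of_pinnedPartner L μ w.1 (cmLocalIntegralLevel L 3 (qsForm L) w.1) (𝔣.𝔥.KH w.1) (𝔣.𝔳.νQ w) (𝔣.𝔳.νHw w)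
    (𝔣.𝔳.mH w) (𝔣.𝔳.mQ w) hK.2 hK.1 tw ρw I hI hlineI hIt hβI⟩

end FrozenGeneric

end Summit.HodgeConjecture.HodgeConjecture.R90.S10

end
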